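import Summits.AtomisticToContinuum.Crystallization.Theorems.OverbindingBudgetAffineFarFieldCellAffine
import Literature.Barriers.AtomisticToContinuum.TetrahedralFrustrationProofs

/-!
# Overbinding budget — far-field Voronoi cells, part 27V «CellVoronoiSandwich»: the SANDWICH CERTIFICATE

Route `OverbindingBudget`, crux `RobustDefectLimitWindows` (stmt-31280), line (2c), leaf SW♭(30),
part 27V «Voronoi-cell quadrature of the far field».  ATLAS-FREE and CONVENTION-FREE.

The one geometric lemma the ledger `farField_ledger` (CellLedger) consumes through its binders
`hIK : affMap 0 y A '' K_in ⊆ K` and `hKO : K ⊆ affMap 0 y A '' K_out`: if the neighbour shell of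
an atom `y` is, up to displacements `≤ δ₀`, the image under ONE chart `A` of an ideal shell
`v : ι → ℝ³` (`‖v i‖ = ν`), and every other atom is at distance `≥ 2a(1−s)r` from `y`, then the
VORONOI CELL of `y` (Hales's `voronoiCell`, Literature, by name) is sandwiched between the
`A`-images of the shell cells at scales `1 − s` and `1 + s`:
* `image_shellCell_subset_voronoiCell` (inner inclusion, for EVERY point of the template — no
  face enumeration) under `(1−s)·m·λ²ν²/2 + a·δ₀·((1−s)r + ν) ≤ s(1−m)·λ²ν²/2`;
* `voronoiCell_subset_image_shellCell` (outer inclusion, by a max-over-the-shell rescaling —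
  no topology) under `(1+s)·m·λ²ν²/2 + a·δ₀·((1+s)r + ν) + δ₀²/2 < s(1−m)·λ²ν²/2`.
Here the chart enters ONLY through its norm `‖A‖ ≤ a` and its CONFORMAL DISTORTION
`|⟪Au, Aw⟫ − λ²⟪u, w⟫| ≤ m·λ²‖u‖‖w‖` with the local dilation `λ` FREE (a pure dilation costs
nothing: the Voronoi construction is dilation-equivariant); CellVoronoiFeed derives `m = 2ε + ε²`
from `‖A − λR‖ ≤ ελ`.  The shell cell `shellCell v c = ⋂ᵢ {u | ⟪u, v i⟫ ≤ c‖v i‖²/2}`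
is the template (the rhombic / trapezo-rhombic dodecahedra of CellRD / CellTRD are shell cells of
the fcc / hcp first shells — proved downstream, where the shell families are fixed); its only
input here is a circumradius `shellCell v 1 ⊆ B̄(0, r)` with `r² ≤ ν²/2`, which yields the FACE RADIUS
bound `‖u − v/2‖ ≤ ν/2 + p/ν` at slack `p = ν²/2 − ⟪u, v⟫` (`norm_sub_half_smul_le`).
The corollaries feeding the ledger's `hK / hKs / hvol / hd` (compact, star-convex, positive volume,
a.e.-disjoint) are in CellVoronoiFeed.  CONVENTION (ledger): window-truncated cells are NOT movers —
a cell whose atom has an incomplete shell is put in the core/collar set `Uc₁` of the ledger, never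
certified here.
-/

namespace Summit.AtomisticToContinuum.Crystallization.Theorems.OverbindingBudgetAffineFarFieldCellVoronoi

noncomputable section

open Set
open Literature.Barriers.AtomisticToContinuum (voronoiCell)
open Summit.AtomisticToContinuum.Crystallization.Theorems.OverbindingBudgetAffineFarFieldCellAffine

local notation "E3" => EuclideanSpace ℝ (Fin 3)

/-! ## The Voronoi cell in bisector form; the shell cell -/

/-- support: Hales's Voronoi cell in bisector (half-space) form about its centre. [this file] -/
theorem mem_voronoiCell_iff_inner (Z : Set E3) (y x : E3) :
    x ∈ voronoiCell Z y ↔ ∀ z ∈ Z, 2 * inner ℝ (x - y) (z - y) ≤ ‖z - y‖ ^ 2 := by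
  refine forall₂_congr fun z _ => ?_
  rw [dist_eq_norm, dist_eq_norm, ← sq_le_sq₀ (norm_nonneg _) (norm_nonneg _),
    show x - z = (x - y) - (z - y) by abel, norm_sub_sq_real (x - y) (z - y)]
  constructor <;> intro h <;> linarith

/-- support: the SHELL CELL of a shell family `v : ι → ℝ³` at scale `c`: the intersection of the
bisector half-spaces `⟪u, v i⟫ ≤ c·‖v i‖²/2`. [this file] -/
def shellCell {ι : Type*} (v : ι → E3) (c : ℝ) : Set E3 :=
  {u | ∀ i, inner ℝ u (v i) ≤ c * ‖v i‖ ^ 2 / 2}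

/-- support: membership in the shell cell. [this file] -/
theorem mem_shellCell {ι : Type*} (v : ι → E3) (c : ℝ) (u : E3) :
    u ∈ shellCell v c ↔ ∀ i, inner ℝ u (v i) ≤ c * ‖v i‖ ^ 2 / 2 := Iff.rfl

/-- support: rescaling out of the unit shell cell. [this file] -/
theorem smul_mem_shellCell {ι : Type*} {v : ι → E3} {c : ℝ} (hc : 0 ≤ c) {u : E3}
    (hu : u ∈ shellCell v 1) : c • u ∈ shellCell v c := fun i => by
  rw [real_inner_smul_left]
  have := mul_le_mul_of_nonneg_left (hu i) hc
  linarith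

/-- support: rescaling into the unit shell cell. [this file] -/
theorem inv_smul_mem_shellCell {ι : Type*} {v : ι → E3} {c : ℝ} (hc : 0 < c) {u : E3}
    (hu : u ∈ shellCell v c) : c⁻¹ • u ∈ shellCell v 1 := fun i => by
  rw [real_inner_smul_left, one_mul]
  calc c⁻¹ * inner ℝ u (v i) ≤ c⁻¹ * (c * ‖v i‖ ^ 2 / 2) :=
        mul_le_mul_of_nonneg_left (hu i) (inv_pos.2 hc).le
    _ = ‖v i‖ ^ 2 / 2 := by rw [mul_div_assoc, ← mul_assoc, inv_mul_cancel₀ hc.ne', one_mul]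

/-! ## The two pointwise estimates -/

/-- support: FACE RADIUS — if `‖w‖ = ν`, `‖u‖ ≤ r`, `r² ≤ ν²/2` and `⟪u, w⟫ = ν²/2 − p` with
`p ≥ 0`, then `‖u − w/2‖ ≤ ν/2 + p/ν` (from `‖u − w/2‖² = ‖u‖² − ⟪u, w⟫ + ν²/4 ≤ ν²/4 + p`).
[this file] -/
theorem norm_sub_half_smul_le {u w : E3} {ν r p : ℝ} (hν : 0 < ν) (hw : ‖w‖ = ν)
    (hr : r ^ 2 ≤ ν ^ 2 / 2) (hu : ‖u‖ ≤ r) (hp : inner ℝ u w = ν ^ 2 / 2 - p) (hp0 : 0 ≤ p) :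
    ‖u - (1 / 2 : ℝ) • w‖ ≤ ν / 2 + p / ν := by
  have hu2 : ‖u‖ ^ 2 ≤ ν ^ 2 / 2 := (pow_le_pow_left₀ (norm_nonneg _) hu 2).trans hr
  have hsq : ‖u - (1 / 2 : ℝ) • w‖ ^ 2 = ‖u‖ ^ 2 - inner ℝ u w + ν ^ 2 / 4 := by
    rw [norm_sub_sq_real, real_inner_smul_right, norm_smul, hw, Real.norm_eq_abs,
      abs_of_pos (by norm_num : (0 : ℝ) < 1 / 2)]
    ring
  have hb : 0 ≤ ν / 2 + p / ν := by positivity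
  have hexp : (ν / 2 + p / ν) ^ 2 = ν ^ 2 / 4 + p + (p / ν) ^ 2 := by
    field_simp
    ring
  have h := abs_le_of_sq_le_sq (a := ‖u - (1 / 2 : ℝ) • w‖) (b := ν / 2 + p / ν)
    (by rw [hsq, hexp, hp]; nlinarith [sq_nonneg (p / ν)]) hb
  rwa [abs_norm] at h

/-- support: the conformal splitting `⟪Au, Aw⟫ = λ²⟪u, w⟫ + B(u − w/2, w) + (‖Aw‖² − λ²‖w‖²)/2`
with `B(u, w) = ⟪Au, Aw⟫ − λ²⟪u, w⟫`. [this file] -/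
theorem inner_map_map_eq (A : E3 ≃L[ℝ] E3) (lam : ℝ) (u w : E3) :
    inner ℝ (A u) (A w) = lam ^ 2 * inner ℝ u w
      + (inner ℝ (A (u - (1 / 2 : ℝ) • w)) (A w) - lam ^ 2 * inner ℝ (u - (1 / 2 : ℝ) • w) w)
      + (‖A w‖ ^ 2 - lam ^ 2 * ‖w‖ ^ 2) / 2 := by
  rw [map_sub, map_smul, inner_sub_left, inner_sub_left, real_inner_smul_left, real_inner_smul_left,
    real_inner_self_eq_norm_sq, real_inner_self_eq_norm_sq]
  ring

/-- support: `‖Aw‖² ≥ (1 − m)λ²‖w‖²` under the conformal distortion bound. [this file] -/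
theorem norm_map_sq_ge (A : E3 ≃L[ℝ] E3) {lam m : ℝ}
    (hB : ∀ u w : E3, |inner ℝ (A u) (A w) - lam ^ 2 * inner ℝ u w| ≤ m * lam ^ 2 * ‖u‖ * ‖w‖)
    (w : E3) : (1 - m) * lam ^ 2 * ‖w‖ ^ 2 ≤ ‖A w‖ ^ 2 := by
  have h := hB w w
  rw [real_inner_self_eq_norm_sq, real_inner_self_eq_norm_sq] at h
  have := neg_abs_le (‖A w‖ ^ 2 - lam ^ 2 * ‖w‖ ^ 2)
  nlinarith
set_option maxHeartbeats 400000 in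
/-- support: INNER POINTWISE ESTIMATE — at slack `p ≥ 0` every point `(1−s)u₀` of the shrunken
template satisfies the bisector constraint of the near atom `y + A w + d`, `‖d‖ ≤ δ₀`. [this file] -/
theorem inner_le_of_shell (A : E3 ≃L[ℝ] E3) {lam m a δ₀ s ν r p : ℝ} {u₀ w d : E3}
    (hν : 0 < ν) (hw : ‖w‖ = ν) (hr : r ^ 2 ≤ ν ^ 2 / 2) (hu₀ : ‖u₀‖ ≤ r)
    (hp : inner ℝ u₀ w = ν ^ 2 / 2 - p) (hp0 : 0 ≤ p) (hm0 : 0 ≤ m) (hm1 : m ≤ 1)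
    (hB : ∀ u w : E3, |inner ℝ (A u) (A w) - lam ^ 2 * inner ℝ u w| ≤ m * lam ^ 2 * ‖u‖ * ‖w‖)
    (ha : ‖(A : E3 →L[ℝ] E3)‖ ≤ a) (hd : ‖d‖ ≤ δ₀) (hs0 : 0 ≤ s) (hs1 : s ≤ 1)
    (hin : (1 - s) * m * lam ^ 2 * ν ^ 2 / 2 + a * δ₀ * ((1 - s) * r + ν)
      ≤ s * (1 - m) * lam ^ 2 * ν ^ 2 / 2) :
    2 * inner ℝ (A ((1 - s) • u₀)) (A w + d) ≤ ‖A w + d‖ ^ 2 := by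
  have ha0 : 0 ≤ a := (norm_nonneg _).trans ha
  have hδ : 0 ≤ δ₀ := (norm_nonneg _).trans hd
  have hr0 : 0 ≤ r := (norm_nonneg _).trans hu₀
  have hX := norm_map_sq_ge A hB w
  rw [hw] at hX
  -- the conformal remainder on the face
  have hface := norm_sub_half_smul_le hν hw hr hu₀ hp hp0
  have hBt : inner ℝ (A (u₀ - (1 / 2 : ℝ) • w)) (A w) - lam ^ 2 * inner ℝ (u₀ - (1 / 2 : ℝ) • w) w
      ≤ m * lam ^ 2 * (ν ^ 2 / 2 + p) := by
    have h1 := (le_abs_self _).trans (hB (u₀ - (1 / 2 : ℝ) • w) w)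
    rw [hw] at h1
    have h2 : m * lam ^ 2 * ‖u₀ - (1 / 2 : ℝ) • w‖ * ν ≤ m * lam ^ 2 * (ν / 2 + p / ν) * ν :=
      mul_le_mul_of_nonneg_right (mul_le_mul_of_nonneg_left hface (by positivity)) hν.le
    have h3 : m * lam ^ 2 * (ν / 2 + p / ν) * ν = m * lam ^ 2 * (ν ^ 2 / 2 + p) := by
      rw [mul_assoc (m * lam ^ 2), add_mul, div_mul_cancel₀ p hν.ne']
      ring
    linarith
  -- the displacement terms
  have hAu : inner ℝ (A u₀) d ≤ a * r * δ₀ := by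
    have h1 := (le_abs_self _).trans (abs_real_inner_le_norm (A u₀) d)
    have h2 : ‖A u₀‖ ≤ a * r :=
      ((A : E3 →L[ℝ] E3).le_opNorm u₀).trans (mul_le_mul ha hu₀ (norm_nonneg _) ha0)
    nlinarith [norm_nonneg d, norm_nonneg (A u₀), mul_le_mul h2 hd (norm_nonneg _) (by positivity)]
  have hAw : -(a * ν * δ₀) ≤ inner ℝ (A w) d := by
    have h1 := (neg_abs_le _).trans' (neg_le_neg (abs_real_inner_le_norm (A w) d))
    have h2 : ‖A w‖ ≤ a * ν := ((A : E3 →L[ℝ] E3).le_opNorm w).trans (by rw [hw]; gcongr)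
    nlinarith [norm_nonneg d, norm_nonneg (A w), mul_le_mul h2 hd (norm_nonneg _) (by positivity)]
  -- assemble
  have hdec := inner_map_map_eq A lam u₀ w
  rw [hp, hw] at hdec
  have hL : 2 * inner ℝ (A ((1 - s) • u₀)) (A w + d)
      = 2 * (1 - s) * (inner ℝ (A u₀) (A w) + inner ℝ (A u₀) d) := by
    rw [map_smul, inner_add_right, real_inner_smul_left, real_inner_smul_left]; ring
  have hR : ‖A w + d‖ ^ 2 = ‖A w‖ ^ 2 + 2 * inner ℝ (A w) d + ‖d‖ ^ 2 := norm_add_sq_real _ _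
  have h1s : 0 ≤ 1 - s := by linarith
  have hsum : (1 - s) * (inner ℝ (A u₀) (A w) + inner ℝ (A u₀) d)
      ≤ (1 - s) * (lam ^ 2 * (ν ^ 2 / 2 - p) + m * lam ^ 2 * (ν ^ 2 / 2 + p)
          + (‖A w‖ ^ 2 - lam ^ 2 * ν ^ 2) / 2 + a * r * δ₀) :=
    mul_le_mul_of_nonneg_left (by linarith) h1s
  have hsX : s * ((1 - m) * lam ^ 2 * ν ^ 2) ≤ s * ‖A w‖ ^ 2 := mul_le_mul_of_nonneg_left hX hs0
  have hpp : 0 ≤ (1 - s) * ((1 - m) * lam ^ 2 * p) :=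
    mul_nonneg h1s (mul_nonneg (mul_nonneg (by linarith) (sq_nonneg _)) hp0)
  have hid : ‖A w‖ ^ 2 + 2 * (-(a * ν * δ₀)) - 2 * ((1 - s) * (lam ^ 2 * (ν ^ 2 / 2 - p)
      + m * lam ^ 2 * (ν ^ 2 / 2 + p) + (‖A w‖ ^ 2 - lam ^ 2 * ν ^ 2) / 2 + a * r * δ₀))
      = (s * ‖A w‖ ^ 2 - s * ((1 - m) * lam ^ 2 * ν ^ 2)) + 2 * ((1 - s) * ((1 - m) * lam ^ 2 * p))
        + 2 * (s * (1 - m) * lam ^ 2 * ν ^ 2 / 2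
          - ((1 - s) * m * lam ^ 2 * ν ^ 2 / 2 + a * δ₀ * ((1 - s) * r + ν))) := by
    ring
  have hnn : 0 ≤ ‖A w‖ ^ 2 + 2 * (-(a * ν * δ₀)) - 2 * ((1 - s) * (lam ^ 2 * (ν ^ 2 / 2 - p)
      + m * lam ^ 2 * (ν ^ 2 / 2 + p) + (‖A w‖ ^ 2 - lam ^ 2 * ν ^ 2) / 2 + a * r * δ₀)) := by
    rw [hid]
    exact add_nonneg (add_nonneg (by linarith) (by linarith)) (by linarith)
  rw [hL, hR]
  nlinarith [hsum, hnn, sq_nonneg ‖d‖, hAw]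

/-- support: OUTER POINTWISE ESTIMATE — at a FACE point `u₀` (`⟪u₀, w⟫ = ν²/2`) the inflated point
`(1+s)u₀` violates the bisector constraint of the near atom `y + A w + d` STRICTLY. [this file] -/
theorem inner_gt_of_face (A : E3 ≃L[ℝ] E3) {lam m a δ₀ s ν r : ℝ} {u₀ w d : E3}
    (hν : 0 < ν) (hw : ‖w‖ = ν) (hr : r ^ 2 ≤ ν ^ 2 / 2) (hu₀ : ‖u₀‖ ≤ r)
    (hp : inner ℝ u₀ w = ν ^ 2 / 2) (hm0 : 0 ≤ m)
    (hB : ∀ u w : E3, |inner ℝ (A u) (A w) - lam ^ 2 * inner ℝ u w| ≤ m * lam ^ 2 * ‖u‖ * ‖w‖)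
    (ha : ‖(A : E3 →L[ℝ] E3)‖ ≤ a) (hd : ‖d‖ ≤ δ₀) (hs0 : 0 ≤ s)
    (hout : (1 + s) * m * lam ^ 2 * ν ^ 2 / 2 + a * δ₀ * ((1 + s) * r + ν)
      + δ₀ ^ 2 / 2 < s * (1 - m) * lam ^ 2 * ν ^ 2 / 2) :
    ‖A w + d‖ ^ 2 < 2 * inner ℝ (A ((1 + s) • u₀)) (A w + d) := by
  have ha0 : 0 ≤ a := (norm_nonneg _).trans ha
  have hδ : 0 ≤ δ₀ := (norm_nonneg _).trans hd
  have hr0 : 0 ≤ r := (norm_nonneg _).trans hu₀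
  have hX := norm_map_sq_ge A hB w
  rw [hw] at hX
  have hface := norm_sub_half_smul_le (p := 0) hν hw hr hu₀ (by rw [hp]; ring) le_rfl
  rw [zero_div, add_zero] at hface
  have hBt : -(m * lam ^ 2 * (ν ^ 2 / 2))
      ≤ inner ℝ (A (u₀ - (1 / 2 : ℝ) • w)) (A w) - lam ^ 2 * inner ℝ (u₀ - (1 / 2 : ℝ) • w) w := by
    have h1 := (neg_abs_le _).trans' (neg_le_neg (hB (u₀ - (1 / 2 : ℝ) • w) w))
    rw [hw] at h1
    have h2 : m * lam ^ 2 * ‖u₀ - (1 / 2 : ℝ) • w‖ * ν ≤ m * lam ^ 2 * (ν / 2) * ν :=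
      mul_le_mul_of_nonneg_right (mul_le_mul_of_nonneg_left hface (by positivity)) hν.le
    nlinarith
  have hAu : -(a * r * δ₀) ≤ inner ℝ (A u₀) d := by
    have h1 := (neg_abs_le _).trans' (neg_le_neg (abs_real_inner_le_norm (A u₀) d))
    have h2 : ‖A u₀‖ ≤ a * r :=
      ((A : E3 →L[ℝ] E3).le_opNorm u₀).trans (mul_le_mul ha hu₀ (norm_nonneg _) ha0)
    nlinarith [norm_nonneg d, norm_nonneg (A u₀), mul_le_mul h2 hd (norm_nonneg _) (by positivity)]
  have hAw : inner ℝ (A w) d ≤ a * ν * δ₀ := by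
    have h1 := (le_abs_self _).trans (abs_real_inner_le_norm (A w) d)
    have h2 : ‖A w‖ ≤ a * ν := ((A : E3 →L[ℝ] E3).le_opNorm w).trans (by rw [hw]; gcongr)
    nlinarith [norm_nonneg d, norm_nonneg (A w), mul_le_mul h2 hd (norm_nonneg _) (by positivity)]
  have hdd : ‖d‖ ^ 2 ≤ δ₀ ^ 2 := pow_le_pow_left₀ (norm_nonneg _) hd 2
  have hdec := inner_map_map_eq A lam u₀ w
  rw [hp, hw] at hdec
  have hL : 2 * inner ℝ (A ((1 + s) • u₀)) (A w + d)
      = 2 * (1 + s) * (inner ℝ (A u₀) (A w) + inner ℝ (A u₀) d) := by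
    rw [map_smul, inner_add_right, real_inner_smul_left, real_inner_smul_left]; ring
  have hR : ‖A w + d‖ ^ 2 = ‖A w‖ ^ 2 + 2 * inner ℝ (A w) d + ‖d‖ ^ 2 := norm_add_sq_real _ _
  have h1s : 0 ≤ 1 + s := by linarith
  have hsum : (1 + s) * (lam ^ 2 * (ν ^ 2 / 2) - m * lam ^ 2 * (ν ^ 2 / 2)
        + (‖A w‖ ^ 2 - lam ^ 2 * ν ^ 2) / 2 - a * r * δ₀)
      ≤ (1 + s) * (inner ℝ (A u₀) (A w) + inner ℝ (A u₀) d) :=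
    mul_le_mul_of_nonneg_left (by linarith) h1s
  have hsX : s * ((1 - m) * lam ^ 2 * ν ^ 2) ≤ s * ‖A w‖ ^ 2 := mul_le_mul_of_nonneg_left hX hs0
  have hid : 2 * ((1 + s) * (lam ^ 2 * (ν ^ 2 / 2) - m * lam ^ 2 * (ν ^ 2 / 2)
        + (‖A w‖ ^ 2 - lam ^ 2 * ν ^ 2) / 2 - a * r * δ₀)) - (‖A w‖ ^ 2 + 2 * (a * ν * δ₀) + δ₀ ^ 2)
      = (s * ‖A w‖ ^ 2 - s * ((1 - m) * lam ^ 2 * ν ^ 2))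
        + 2 * (s * (1 - m) * lam ^ 2 * ν ^ 2 / 2 - ((1 + s) * m * lam ^ 2 * ν ^ 2 / 2
          + a * δ₀ * ((1 + s) * r + ν) + δ₀ ^ 2 / 2)) := by
    ring
  have hpos : 0 < 2 * ((1 + s) * (lam ^ 2 * (ν ^ 2 / 2) - m * lam ^ 2 * (ν ^ 2 / 2)
        + (‖A w‖ ^ 2 - lam ^ 2 * ν ^ 2) / 2 - a * r * δ₀)) - (‖A w‖ ^ 2 + 2 * (a * ν * δ₀) + δ₀ ^ 2) := by
    rw [hid]
    exact add_pos_of_nonneg_of_pos (by linarith) (by linarith)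
  rw [hL, hR]
  nlinarith [hsum, hpos, hdd, hAw]

/-! ## The sandwich -/

/-- support: INNER INCLUSION — the chart image of the shell cell at scale `1 − s` lies in the
Voronoi cell of `y`, provided every atom is either `δ₀`-close to a charted shell point `y + A(v i)`
or at distance `≥ 2a(1−s)r` from `y`, and `(1−s)·m·λ²ν²/2 + a·δ₀·((1−s)r + ν) ≤ s(1−m)·λ²ν²/2`.
[this file] -/
theorem image_shellCell_subset_voronoiCell {ι : Type*} {v : ι → E3} {ν r lam m a δ₀ s : ℝ}
    {A : E3 ≃L[ℝ] E3} {y : E3} {Z : Set E3}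
    (hν : 0 < ν) (hV : ∀ i, ‖v i‖ = ν) (hr : r ^ 2 ≤ ν ^ 2 / 2)
    (hball : shellCell v 1 ⊆ Metric.closedBall 0 r) (hm0 : 0 ≤ m) (hm1 : m ≤ 1)
    (hB : ∀ u w : E3, |inner ℝ (A u) (A w) - lam ^ 2 * inner ℝ u w| ≤ m * lam ^ 2 * ‖u‖ * ‖w‖)
    (ha : ‖(A : E3 →L[ℝ] E3)‖ ≤ a) (hs0 : 0 ≤ s) (hs1 : s < 1)
    (hZ : ∀ z ∈ Z, (∃ i, ‖z - (y + A (v i))‖ ≤ δ₀) ∨ 2 * a * (1 - s) * r ≤ ‖z - y‖)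
    (hin : (1 - s) * m * lam ^ 2 * ν ^ 2 / 2 + a * δ₀ * ((1 - s) * r + ν)
      ≤ s * (1 - m) * lam ^ 2 * ν ^ 2 / 2) :
    affMap 0 y A '' shellCell v (1 - s) ⊆ voronoiCell Z y := by
  rintro _ ⟨u, hu, rfl⟩
  rw [mem_voronoiCell_iff_inner]
  intro z hz
  have hx : affMap 0 y A u - y = A u := by simp [affMap]
  rw [hx]
  have h1s : 0 < 1 - s := by linarith
  have ha0 : 0 ≤ a := (norm_nonneg _).trans ha
  set u₀ : E3 := (1 - s)⁻¹ • u with hu₀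
  have huu : u = (1 - s) • u₀ := by rw [hu₀, smul_smul, mul_inv_cancel₀ h1s.ne', one_smul]
  have hu₀1 : u₀ ∈ shellCell v 1 := inv_smul_mem_shellCell h1s hu
  have hn : ‖u₀‖ ≤ r := by
    have := hball hu₀1
    rwa [Metric.mem_closedBall, dist_zero_right] at this
  rcases hZ z hz with ⟨i, hi⟩ | hfar
  · -- a shell atom: the pointwise inner estimate at slack p
    set d : E3 := z - (y + A (v i)) with hd
    have hz' : z - y = A (v i) + d := by rw [hd]; abel
    rw [hz', huu]
    have hp0 : 0 ≤ ν ^ 2 / 2 - inner ℝ u₀ (v i) := by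
      have := hu₀1 i
      rw [hV i, one_mul] at this
      linarith
    exact inner_le_of_shell A hν (hV i) hr hn (by ring) hp0 hm0 hm1 hB ha hi hs0 hs1.le hin
  · -- a far atom: the ball argument
    have hAu : ‖A u‖ ≤ a * ((1 - s) * r) := by
      refine ((A : E3 →L[ℝ] E3).le_opNorm u).trans (mul_le_mul ha ?_ (norm_nonneg _) ha0)
      rw [huu, norm_smul, Real.norm_eq_abs, abs_of_pos h1s]
      exact mul_le_mul_of_nonneg_left hn h1s.le
    have h2 : 2 * ‖A u‖ ≤ ‖z - y‖ := by linarith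
    have h4 := (le_abs_self _).trans (abs_real_inner_le_norm (A u) (z - y))
    nlinarith [norm_nonneg (z - y), norm_nonneg (A u), mul_le_mul_of_nonneg_right h2 (norm_nonneg (z - y))]

/-- support: OUTER INCLUSION — the Voronoi cell of `y` lies in the chart image of the shell cell at
scale `1 + s`, provided every shell point `y + A(v i)` has an atom within `δ₀` and
`(1+s)·m·λ²ν²/2 + a·δ₀·((1+s)r + ν) + δ₀²/2 < s(1−m)·λ²ν²/2`.  Proof without topology: for
`x = y + Au` in the cell, rescale `u` onto the most-violated face (`Finset.exists_max_image`) and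
apply `inner_gt_of_face`. [this file] -/
theorem voronoiCell_subset_image_shellCell {ι : Type*} [Fintype ι] [Nonempty ι] {v : ι → E3}
    {ν r lam m a δ₀ s : ℝ} {A : E3 ≃L[ℝ] E3} {y : E3} {Z : Set E3}
    (hν : 0 < ν) (hV : ∀ i, ‖v i‖ = ν) (hr : r ^ 2 ≤ ν ^ 2 / 2)
    (hball : shellCell v 1 ⊆ Metric.closedBall 0 r) (hm0 : 0 ≤ m)
    (hB : ∀ u w : E3, |inner ℝ (A u) (A w) - lam ^ 2 * inner ℝ u w| ≤ m * lam ^ 2 * ‖u‖ * ‖w‖)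
    (ha : ‖(A : E3 →L[ℝ] E3)‖ ≤ a) (hs0 : 0 ≤ s)
    (hnear : ∀ i, ∃ z ∈ Z, ‖z - (y + A (v i))‖ ≤ δ₀)
    (hout : (1 + s) * m * lam ^ 2 * ν ^ 2 / 2 + a * δ₀ * ((1 + s) * r + ν)
      + δ₀ ^ 2 / 2 < s * (1 - m) * lam ^ 2 * ν ^ 2 / 2) :
    voronoiCell Z y ⊆ affMap 0 y A '' shellCell v (1 + s) := by
  intro x hx
  rw [mem_voronoiCell_iff_inner] at hx
  refine ⟨A.symm (x - y), ?_, by simp [affMap]⟩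
  set u : E3 := A.symm (x - y) with hu
  have hAu : A u = x - y := A.apply_symm_apply _
  intro i₁
  rw [hV i₁]
  by_contra hle
  have hlt := lt_of_not_ge hle
  obtain ⟨i, -, hmax⟩ :=
    Finset.exists_max_image Finset.univ (fun j => inner ℝ u (v j)) Finset.univ_nonempty
  have hM : (1 + s) * ν ^ 2 / 2 < inner ℝ u (v i) := hlt.trans_le (hmax i₁ (Finset.mem_univ _))
  have h1s : 0 < 1 + s := by linarith
  have hpos : 0 < (1 + s) * ν ^ 2 / 2 := by positivity
  have hMpos : 0 < inner ℝ u (v i) := hpos.trans hM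
  -- rescale onto the face of `i`
  set c : ℝ := (1 + s) * ν ^ 2 / 2 / inner ℝ u (v i) with hc
  have hc0 : 0 < c := div_pos hpos hMpos
  have hc1 : c ≤ 1 := (div_le_one hMpos).2 hM.le
  have hcM : c * inner ℝ u (v i) = (1 + s) * ν ^ 2 / 2 := div_mul_cancel₀ _ hMpos.ne'
  set u₀ : E3 := (c / (1 + s)) • u with hu₀
  have hu₀1 : u₀ ∈ shellCell v 1 := fun j => by
    rw [hu₀, real_inner_smul_left, hV j, one_mul]
    have h1 : c / (1 + s) * inner ℝ u (v j) ≤ c / (1 + s) * inner ℝ u (v i) :=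
      mul_le_mul_of_nonneg_left (hmax j (Finset.mem_univ _)) (div_nonneg hc0.le h1s.le)
    have h2 : c / (1 + s) * inner ℝ u (v i) = ν ^ 2 / 2 := by
      rw [div_mul_eq_mul_div, hcM]; field_simp
    linarith
  have hface : inner ℝ u₀ (v i) = ν ^ 2 / 2 := by
    rw [hu₀, real_inner_smul_left, div_mul_eq_mul_div, hcM]; field_simp
  have hn : ‖u₀‖ ≤ r := by
    have := hball hu₀1
    rwa [Metric.mem_closedBall, dist_zero_right] at this
  obtain ⟨z, hz, hzd⟩ := hnear i
  set d : E3 := z - (y + A (v i)) with hd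
  have hz' : z - y = A (v i) + d := by rw [hd]; abel
  have key := inner_gt_of_face A hν (hV i) hr hn hface hm0 hB ha hzd hs0 hout
  have hxz := hx z hz
  rw [← hAu, hz'] at hxz
  -- `(1+s) • u₀ = c • u`, so the face violation transfers to `x` since `0 < c ≤ 1`
  have hsc : (1 + s) • u₀ = c • u := by rw [hu₀, smul_smul, mul_div_cancel₀ _ h1s.ne']
  rw [hsc, map_smul, real_inner_smul_left] at key
  have hI : 0 < inner ℝ (A u) (A (v i) + d) := by
    have h1 : 0 < c * inner ℝ (A u) (A (v i) + d) := by nlinarith [sq_nonneg ‖A (v i) + d‖]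
    exact pos_of_mul_pos_right h1 hc0.le
  have hcI : c * inner ℝ (A u) (A (v i) + d) ≤ 1 * inner ℝ (A u) (A (v i) + d) :=
    mul_le_mul_of_nonneg_right hc1 hI.le
  linarith

end

end Summit.AtomisticToContinuum.Crystallization.Theorems.OverbindingBudgetAffineFarFieldCellVoronoi
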